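import Summits.QuantumFields.YangMills.Theorems.UnitScaleTiltAvgCurvGradWords
import HarnessLib

/-!
# Route `UnitScaleTilt`, crux K1 child «MinimiserStabilityRegPr» (stmt-QuantumFields-19200), stub `stub_avgCurvGrad` — helper A2:
# THE COVARIANT WORD-GRADIENT STOKES BOUND — if every plaquette variable is within `a` of `1` and every backward covariant
# derivative (direction `ν`) of every plaquette field is `≤ b`, then for every CLOSED word `w` with `|w| ≤ ℓ` the backward covariant
# derivative of the holonomy functional `x ↦ 𝒰_x(w)` is `≤ (|w|²/4)·(b + (32 + 2ℓ²)·a²)`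

Cell `ym3-torus` ∕ fleet seat `ym-ust-19200-p1` (HUMAN RULING D-0037, YM ladder rung R3); sequel of helper A1 `UnitScaleTiltAvgCurvGradWords`
(notation there: `𝒰_x(w) = holAt U (walk x w)`, `β_x = U⟨x − e_ν, x⟩`, `∇_ν𝒰_x(w) = β_x⁻¹·𝒰_{x−e_ν}(w)·β_x − 𝒰_x(w)`, `SU(N)` read in `M_N(ℂ)`).
Hypotheses throughout: `PlaqSmall a U` (`a ≥ 0`) and `‖∇_ν𝒰_y(plaqWord κ κ′)‖ ≤ b` for all `y` and all `κ ≠ κ′` (`b ≥ 0`).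

THE ARGUMENT (the swap calculus of `LatticeWordStokes`, one order higher).
* ROTATION: for a closed word `AB`, `‖∇_ν𝒰_x(AB)‖ ≤ ‖∇_ν𝒰_y(BA)‖ + 2(|A|+1)²a·|𝒰(BA) − 1|` (helper A1 §2).
* THE DEFECT GRADIENT: the commutator defect of two letters is the holonomy of `m₁m₂m̄₁m̄₂`, a rotation by ≤ 3 letters of a plaquette word,
  so its gradient is `≤ b + 32a²`.
* A TRANSPOSITION `A m₁ m₂ C → A m₂ m₁ C` changes `∇_ν𝒰` by at most the gradient of the defect at the end of `A` transported back along `A`: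
  `≤ (b + 32a²) + 2(|A|+1)²a·a ≤ ε := b + (32 + 2ℓ²)a²`; backtracks are free; hence `‖∇_ν𝒰_x(A m B m̄ C)‖ ≤ |B|·ε + ‖∇_ν𝒰_x(A B C)‖` and,
  by induction on the length exactly as in `LatticeWordStokes.dist1_holAt_le_of_netDisp_eq_zero`, **`norm_wordGrad_le`**:
  `‖∇_ν𝒰_x(w)‖ ≤ (|w|²/4)·ε` for closed `w`, `|w| ≤ ℓ`.

Elementary lattice gauge kinematics (our own statements, tagged [folklore] / cited to the printed identities they instantiate).

References: T. Bałaban, CMP 98 (1985) 17–51 [Balaban1985Averaging] ((7), (9) pp.18–19, (19)–(20) p.21); CMP 99 (1985) 75–102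
[Balaban1985RegularSpaces] ((1.1) p.76, (1.11) p.77).
-/

noncomputable section

open scoped Matrix.Norms.L2Operator

namespace Summit.QuantumFields.YangMills.Theorems.AvgCurvGrad

open Literature.MathematicalPhysics.QuantumFieldTheory.Balaban1983to89
open T4Continuum LatticeWordStokes
open B7Prop1Explicit (plaqWord)

/-! ## §3 The covariant word gradient: rotations, the defect gradient, transpositions, cancellations, the bound -/

section Gradient

variable {n : Type*} [Fintype n] [DecidableEq n] [Nonempty n] {P : Params} {j : ℕ}
  (U : GaugeField P j (Matrix.specialUnitaryGroup n ℂ))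

/-- **ROTATION**: for a closed word `AB`, `‖∇_ν𝒰_x(AB)‖ ≤ ‖∇_ν𝒰_y(BA)‖ + 2(|A|+1)²a·|𝒰_{y⁻}(BA) − 1|` (`y` the end of `A`) — the
holonomy of `AB` from `x` is the transport along `A` of the holonomy of `BA` from `y` (§1), and §2.
[cite: Balaban1985RegularSpaces, (1.11) p.77] -/
theorem norm_wordGrad_rotate_le {a : ℝ} (ha : 0 ≤ a) (hU : PlaqSmall a U) (x : Site P j) (A B : List (Letter P.d))
    (hAB : ∀ μ, netDisp (A ++ B) μ = 0) (ν : Fin P.d) :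
    ‖(((U ⟨x.unshift ν, ν⟩)⁻¹ * holAt U (walk (x.unshift ν) (A ++ B)) * U ⟨x.unshift ν, ν⟩ :
          Matrix.specialUnitaryGroup n ℂ) : Matrix n n ℂ) - ((holAt U (walk x (A ++ B)) : Matrix.specialUnitaryGroup n ℂ) : Matrix n n ℂ)‖ ≤
      ‖(((U ⟨(walkEnd x A).unshift ν, ν⟩)⁻¹ * holAt U (walk ((walkEnd x A).unshift ν) (B ++ A)) * U ⟨(walkEnd x A).unshift ν, ν⟩ :
            Matrix.specialUnitaryGroup n ℂ) : Matrix n n ℂ) -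
          ((holAt U (walk (walkEnd x A) (B ++ A)) : Matrix.specialUnitaryGroup n ℂ) : Matrix n n ℂ)‖ +
        2 * (((A.length : ℝ) + 1) ^ 2 * a) * dist1 (holAt U (walk ((walkEnd x A).unshift ν) (B ++ A))) := by
  rw [holAt_walk_rotate U x A B hAB, holAt_walk_rotate U (x.unshift ν) A B hAB, walkEnd_unshift]
  exact norm_transport_conj_sub_le U ha hU x A ν _ _

/-- **THE GRADIENT OF THE COMMUTATOR DEFECT**: for any two letters `m₁, m₂` and every site `y`,
`‖β_y⁻¹·D_{y−e_ν}(m₁,m₂)·β_y − D_y(m₁,m₂)‖ ≤ b + 32a²`, `D_y(m₁,m₂) = 𝒰_y(m₁m₂)𝒰_y(m₂m₁)⁻¹`: parallel letters have no defect; otherwise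
the defect is the holonomy of the four-letter word `m₁m₂m̄₁m̄₂`, a rotation by at most three letters of a plaquette word (whose gradient
is `≤ b` by hypothesis and whose holonomy is within `a` of `1`), so §3's rotation bound applies with `(|A|+1)² ≤ 16`.
[cite: Balaban1985RegularSpaces, (1.1) p.76] -/
theorem norm_swapDefectGrad_le {a b : ℝ} (ha : 0 ≤ a) (hb0 : 0 ≤ b) (hU : PlaqSmall a U) (ν : Fin P.d)
    (hb : ∀ (y : Site P j) (κ κ' : Fin P.d), κ ≠ κ' →
      ‖(((U ⟨y.unshift ν, ν⟩)⁻¹ * holAt U (walk (y.unshift ν) (plaqWord κ κ')) * U ⟨y.unshift ν, ν⟩ :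
            Matrix.specialUnitaryGroup n ℂ) : Matrix n n ℂ) -
          ((holAt U (walk y (plaqWord κ κ')) : Matrix.specialUnitaryGroup n ℂ) : Matrix n n ℂ)‖ ≤ b)
    (y : Site P j) (m₁ m₂ : Letter P.d) :
    ‖(((U ⟨y.unshift ν, ν⟩)⁻¹ *
            (holAt U (walk (y.unshift ν) [m₁, m₂]) * (holAt U (walk (y.unshift ν) [m₂, m₁]))⁻¹) * U ⟨y.unshift ν, ν⟩ :
          Matrix.specialUnitaryGroup n ℂ) : Matrix n n ℂ) -
        ((holAt U (walk y [m₁, m₂]) * (holAt U (walk y [m₂, m₁]))⁻¹ : Matrix.specialUnitaryGroup n ℂ) : Matrix n n ℂ)‖ ≤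
      b + 32 * a ^ 2 := by
  obtain ⟨κ, s⟩ := m₁
  obtain ⟨κ', t⟩ := m₂
  have h32 : 0 ≤ 32 * a ^ 2 := by positivity
  by_cases hκ : κ = κ'
  · subst hκ
    rw [swapDefect_eq_one_of_parallel, swapDefect_eq_one_of_parallel, mul_one, inv_mul_cancel, sub_self, norm_zero]
    positivity
  rw [swapDefect_eq_holAt_four, swapDefect_eq_holAt_four]
  -- the generic step: a rotation by a prefix of length `k ≤ 3` of a plaquette word
  have key : ∀ (A B : List (Letter P.d)) (κ₁ κ₂ : Fin P.d), κ₁ ≠ κ₂ → B ++ A = plaqWord κ₁ κ₂ → A.length ≤ 3 →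
      ‖(((U ⟨y.unshift ν, ν⟩)⁻¹ * holAt U (walk (y.unshift ν) (A ++ B)) * U ⟨y.unshift ν, ν⟩ :
            Matrix.specialUnitaryGroup n ℂ) : Matrix n n ℂ) - ((holAt U (walk y (A ++ B)) : Matrix.specialUnitaryGroup n ℂ) : Matrix n n ℂ)‖ ≤
        b + 32 * a ^ 2 := by
    intro A B κ₁ κ₂ hne hBA hA
    have hclosed : ∀ μ, netDisp (A ++ B) μ = 0 := by
      intro μ
      have h := T4ReflectionCone.netDisp_append B A μ
      rw [hBA] at h
      rw [T4ReflectionCone.netDisp_append, add_comm, ← h]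
      rcases lt_or_gt_of_ne hne with hlt | hgt
      · simp only [plaqWord, netDisp, List.map_cons, List.map_nil, List.sum_cons, List.sum_nil]
        by_cases h₁ : κ₁ = μ <;> by_cases h₂ : κ₂ = μ <;> simp [h₁, h₂]
      · simp only [plaqWord, netDisp, List.map_cons, List.map_nil, List.sum_cons, List.sum_nil]
        by_cases h₁ : κ₁ = μ <;> by_cases h₂ : κ₂ = μ <;> simp [h₁, h₂]
    refine (norm_wordGrad_rotate_le U ha hU y A B hclosed ν).trans ?_
    rw [hBA]
    have hd : dist1 (holAt U (walk ((walkEnd y A).unshift ν) (plaqWord κ₁ κ₂))) ≤ a :=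
      (dist1_holAt_plaqWord_lt U hU _ hne).le
    have hA' : ((A.length : ℝ) + 1) ^ 2 ≤ 16 := by
      have : (A.length : ℝ) ≤ 3 := by exact_mod_cast hA
      nlinarith
    have hlad : 2 * (((A.length : ℝ) + 1) ^ 2 * a) * dist1 (holAt U (walk ((walkEnd y A).unshift ν) (plaqWord κ₁ κ₂))) ≤
        32 * a ^ 2 := by
      calc 2 * (((A.length : ℝ) + 1) ^ 2 * a) * dist1 (holAt U (walk ((walkEnd y A).unshift ν) (plaqWord κ₁ κ₂)))
          ≤ 2 * (16 * a) * a := mul_le_mul (mul_le_mul_of_nonneg_left (mul_le_mul_of_nonneg_right hA' ha) zero_le_two) hd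
            (GaugeGroup.dist1_nonneg _) (by positivity)
        _ = 32 * a ^ 2 := by ring
    exact add_le_add (hb _ κ₁ κ₂ hne) hlad
  cases s <;> cases t
  · -- `(−κ)(−κ′)(+κ)(+κ′)`: rotation by two letters of `plaqWord κ κ′`
    exact key [(κ, false), (κ', false)] [(κ, true), (κ', true)] κ κ' hκ rfl (by simp)
  · -- `(−κ)(+κ′)(+κ)(−κ′)`: rotation by one letter of `plaqWord κ′ κ`
    exact key [(κ, false)] [(κ', true), (κ, true), (κ', false)] κ' κ (Ne.symm hκ) rfl (by simp)
  · -- `(+κ)(−κ′)(−κ)(+κ′)`: rotation by three letters of `plaqWord κ′ κ`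
    exact key [(κ, true), (κ', false), (κ, false)] [(κ', true)] κ' κ (Ne.symm hκ) rfl (by simp)
  · -- `(+κ)(+κ′)(−κ)(−κ′) = plaqWord κ κ′`
    exact key [] [(κ, true), (κ', true), (κ, false), (κ', false)] κ κ' hκ rfl (by simp)

/-- **AN ADJACENT TRANSPOSITION COSTS ONE PLAQUETTE GRADIENT**: `‖∇_ν𝒰_x(A m₁ m₂ C)‖ ≤ ε + ‖∇_ν𝒰_x(A m₂ m₁ C)‖`,
`ε = b + (32 + 2ℓ²)a²`, for words of length `≤ ℓ` — the swap identity `𝒰(Am₁m₂C) = [𝒰(A)D𝒰(A)⁻¹]·𝒰(Am₂m₁C)` at both bases, §0's product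
rule, §2 for the transported defect (ladder `(|A|+1)² ≤ ℓ²`, `|D − 1| ≤ a`) and the defect gradient `≤ b + 32a²`.
[cite: Balaban1985Averaging, (9) p.19 and (19)-(20) p.21] -/
theorem norm_wordGrad_swap_le {a b : ℝ} {ℓ : ℕ} (ha : 0 ≤ a) (hb0 : 0 ≤ b) (hU : PlaqSmall a U) (ν : Fin P.d)
    (hb : ∀ (y : Site P j) (κ κ' : Fin P.d), κ ≠ κ' →
      ‖(((U ⟨y.unshift ν, ν⟩)⁻¹ * holAt U (walk (y.unshift ν) (plaqWord κ κ')) * U ⟨y.unshift ν, ν⟩ :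
            Matrix.specialUnitaryGroup n ℂ) : Matrix n n ℂ) -
          ((holAt U (walk y (plaqWord κ κ')) : Matrix.specialUnitaryGroup n ℂ) : Matrix n n ℂ)‖ ≤ b)
    (x : Site P j) (A C : List (Letter P.d)) (m₁ m₂ : Letter P.d) (hlen : (A ++ m₁ :: m₂ :: C).length ≤ ℓ) :
    ‖(((U ⟨x.unshift ν, ν⟩)⁻¹ * holAt U (walk (x.unshift ν) (A ++ m₁ :: m₂ :: C)) * U ⟨x.unshift ν, ν⟩ :
          Matrix.specialUnitaryGroup n ℂ) : Matrix n n ℂ) -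
        ((holAt U (walk x (A ++ m₁ :: m₂ :: C)) : Matrix.specialUnitaryGroup n ℂ) : Matrix n n ℂ)‖ ≤
      (b + (32 + 2 * (ℓ : ℝ) ^ 2) * a ^ 2) +
        ‖(((U ⟨x.unshift ν, ν⟩)⁻¹ * holAt U (walk (x.unshift ν) (A ++ m₂ :: m₁ :: C)) * U ⟨x.unshift ν, ν⟩ :
              Matrix.specialUnitaryGroup n ℂ) : Matrix n n ℂ) -
            ((holAt U (walk x (A ++ m₂ :: m₁ :: C)) : Matrix.specialUnitaryGroup n ℂ) : Matrix n n ℂ)‖ := by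
  rw [holAt_walk_swap_eq U x A C m₁ m₂, holAt_walk_swap_eq U (x.unshift ν) A C m₁ m₂, walkEnd_unshift]
  set β := U ⟨x.unshift ν, ν⟩ with hβ
  set hA := holAt U (walk x A) with hA_def
  set hA' := holAt U (walk (x.unshift ν) A) with hA'_def
  set D := holAt U (walk (walkEnd x A) [m₁, m₂]) * (holAt U (walk (walkEnd x A) [m₂, m₁]))⁻¹ with hD
  set D' := holAt U (walk ((walkEnd x A).unshift ν) [m₁, m₂]) * (holAt U (walk ((walkEnd x A).unshift ν) [m₂, m₁]))⁻¹ with hD'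
  set R := holAt U (walk x (A ++ m₂ :: m₁ :: C)) with hR
  set R' := holAt U (walk (x.unshift ν) (A ++ m₂ :: m₁ :: C)) with hR'
  have hsplit : β⁻¹ * (hA' * D' * hA'⁻¹ * R') * β = (β⁻¹ * (hA' * D' * hA'⁻¹) * β) * (β⁻¹ * R' * β) := by group
  rw [hsplit]
  refine (norm_coe_mul_sub_mul_le _ _ _ _).trans (add_le_add ?_ le_rfl)
  -- the transported defect
  refine (norm_transport_conj_sub_le U ha hU x A ν D D').trans ?_
  have hSD := norm_swapDefectGrad_le U ha hb0 hU ν hb (walkEnd x A) m₁ m₂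
  have hD'1 : dist1 D' ≤ a := dist1_swapDefect_le U ha hU _ m₁ m₂
  have hAℓ : ((A.length : ℝ) + 1) ^ 2 ≤ (ℓ : ℝ) ^ 2 := by
    have h : (A.length : ℝ) + 1 ≤ ℓ := by
      have : A.length + 2 ≤ ℓ := by simp only [List.length_append, List.length_cons] at hlen; omega
      have : ((A.length + 2 : ℕ) : ℝ) ≤ ℓ := by exact_mod_cast this
      push_cast at this; linarith
    exact pow_le_pow_left₀ (by positivity) h 2
  have hlad : 2 * (((A.length : ℝ) + 1) ^ 2 * a) * dist1 D' ≤ 2 * (ℓ : ℝ) ^ 2 * a ^ 2 := by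
    calc 2 * (((A.length : ℝ) + 1) ^ 2 * a) * dist1 D' ≤ 2 * ((ℓ : ℝ) ^ 2 * a) * a :=
          mul_le_mul (mul_le_mul_of_nonneg_left (mul_le_mul_of_nonneg_right hAℓ ha) zero_le_two) hD'1 (GaugeGroup.dist1_nonneg _)
            (by positivity)
      _ = 2 * (ℓ : ℝ) ^ 2 * a ^ 2 := by ring
  calc _ ≤ (b + 32 * a ^ 2) + 2 * (ℓ : ℝ) ^ 2 * a ^ 2 := add_le_add hSD hlad
    _ = b + (32 + 2 * (ℓ : ℝ) ^ 2) * a ^ 2 := by ring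

/-- **BACKTRACKS ARE FREE; MOVING `m̄` LEFTWARD THROUGH `B` TO ITS PARTNER COSTS `|B|·ε`**:
`‖∇_ν𝒰_x(A m B m̄ C)‖ ≤ |B|·ε + ‖∇_ν𝒰_x(A B C)‖` for words of length `≤ ℓ`. [cite: Balaban1985Averaging, (7) and (9) pp.18-19] -/
theorem norm_wordGrad_cancel_le {a b : ℝ} {ℓ : ℕ} (ha : 0 ≤ a) (hb0 : 0 ≤ b) (hU : PlaqSmall a U) (ν : Fin P.d)
    (hb : ∀ (y : Site P j) (κ κ' : Fin P.d), κ ≠ κ' →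
      ‖(((U ⟨y.unshift ν, ν⟩)⁻¹ * holAt U (walk (y.unshift ν) (plaqWord κ κ')) * U ⟨y.unshift ν, ν⟩ :
            Matrix.specialUnitaryGroup n ℂ) : Matrix n n ℂ) -
          ((holAt U (walk y (plaqWord κ κ')) : Matrix.specialUnitaryGroup n ℂ) : Matrix n n ℂ)‖ ≤ b)
    (x : Site P j) (m : Letter P.d) :
    ∀ (B A C : List (Letter P.d)), (A ++ m :: (B ++ m.flip :: C)).length ≤ ℓ →
      ‖(((U ⟨x.unshift ν, ν⟩)⁻¹ * holAt U (walk (x.unshift ν) (A ++ m :: (B ++ m.flip :: C))) * U ⟨x.unshift ν, ν⟩ :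
            Matrix.specialUnitaryGroup n ℂ) : Matrix n n ℂ) -
          ((holAt U (walk x (A ++ m :: (B ++ m.flip :: C))) : Matrix.specialUnitaryGroup n ℂ) : Matrix n n ℂ)‖ ≤
        (B.length : ℝ) * (b + (32 + 2 * (ℓ : ℝ) ^ 2) * a ^ 2) +
          ‖(((U ⟨x.unshift ν, ν⟩)⁻¹ * holAt U (walk (x.unshift ν) (A ++ (B ++ C))) * U ⟨x.unshift ν, ν⟩ :
                Matrix.specialUnitaryGroup n ℂ) : Matrix n n ℂ) -
              ((holAt U (walk x (A ++ (B ++ C))) : Matrix.specialUnitaryGroup n ℂ) : Matrix n n ℂ)‖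
  | [], A, C, _ => by
    simp only [List.nil_append, List.length_nil, Nat.cast_zero, zero_mul, zero_add]
    rw [holAt_walk_backtrack, holAt_walk_backtrack]
  | c :: B, A, C, hlen => by
    have h₁ : A ++ c :: m :: (B ++ m.flip :: C) = (A ++ [c]) ++ m :: (B ++ m.flip :: C) := by simp
    have h₂ : A ++ (c :: B ++ C) = (A ++ [c]) ++ (B ++ C) := by simp
    have hlen₁ : (A ++ m :: c :: (B ++ m.flip :: C)).length ≤ ℓ := by
      simp only [List.length_append, List.length_cons] at hlen ⊢; omega
    have hlen₂ : ((A ++ [c]) ++ m :: (B ++ m.flip :: C)).length ≤ ℓ := by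
      simp only [List.length_append, List.length_cons, List.length_nil] at hlen ⊢; omega
    calc _ ≤ (b + (32 + 2 * (ℓ : ℝ) ^ 2) * a ^ 2) +
          ‖(((U ⟨x.unshift ν, ν⟩)⁻¹ * holAt U (walk (x.unshift ν) (A ++ c :: m :: (B ++ m.flip :: C))) * U ⟨x.unshift ν, ν⟩ :
                Matrix.specialUnitaryGroup n ℂ) : Matrix n n ℂ) -
              ((holAt U (walk x (A ++ c :: m :: (B ++ m.flip :: C))) : Matrix.specialUnitaryGroup n ℂ) : Matrix n n ℂ)‖ :=
          norm_wordGrad_swap_le U ha hb0 hU ν hb x A _ m c hlen₁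
      _ ≤ (b + (32 + 2 * (ℓ : ℝ) ^ 2) * a ^ 2) + (((B.length : ℝ)) * (b + (32 + 2 * (ℓ : ℝ) ^ 2) * a ^ 2) +
          ‖(((U ⟨x.unshift ν, ν⟩)⁻¹ * holAt U (walk (x.unshift ν) (A ++ (c :: B ++ C))) * U ⟨x.unshift ν, ν⟩ :
                Matrix.specialUnitaryGroup n ℂ) : Matrix n n ℂ) -
              ((holAt U (walk x (A ++ (c :: B ++ C))) : Matrix.specialUnitaryGroup n ℂ) : Matrix n n ℂ)‖) := by
          rw [h₁, h₂]
          exact add_le_add le_rfl (norm_wordGrad_cancel_le ha hb0 hU ν hb x m B (A ++ [c]) C hlen₂)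
      _ = (((c :: B).length : ℝ)) * (b + (32 + 2 * (ℓ : ℝ) ^ 2) * a ^ 2) +
          ‖(((U ⟨x.unshift ν, ν⟩)⁻¹ * holAt U (walk (x.unshift ν) (A ++ (c :: B ++ C))) * U ⟨x.unshift ν, ν⟩ :
                Matrix.specialUnitaryGroup n ℂ) : Matrix n n ℂ) -
              ((holAt U (walk x (A ++ (c :: B ++ C))) : Matrix.specialUnitaryGroup n ℂ) : Matrix n n ℂ)‖ := by
          simp only [List.length_cons, Nat.cast_succ]
          ring

/-- A word with positive net displacement in direction `κ` contains the letter `+e_κ`; with negative, the letter `−e_κ`. [folklore] -/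
private theorem mem_of_netDisp_ne' (κ : Fin P.d) : ∀ (w : List (Letter P.d)),
    (0 < netDisp w κ → (κ, true) ∈ w) ∧ (netDisp w κ < 0 → (κ, false) ∈ w)
  | [] => by simp [netDisp]
  | l :: w => by
    obtain ⟨hpos, hneg⟩ := mem_of_netDisp_ne' κ w
    obtain ⟨c, s⟩ := l
    constructor
    · intro h
      rw [netDisp_cons] at h
      by_cases hc : c = κ
      · subst hc
        cases s
        · exact List.mem_cons_of_mem _ (hpos (by simp at h; linarith))
        · exact List.mem_cons_self
      · exact List.mem_cons_of_mem _ (hpos (by simp [hc] at h; exact h))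
    · intro h
      rw [netDisp_cons] at h
      by_cases hc : c = κ
      · subst hc
        cases s
        · exact List.mem_cons_self
        · exact List.mem_cons_of_mem _ (hneg (by simp at h; linarith))
      · exact List.mem_cons_of_mem _ (hneg (by simp [hc] at h; exact h))

/-- The tail of a closed word beginning with `m` contains `m̄`. [folklore] -/
private theorem flip_mem_of_netDisp_eq_zero' (m : Letter P.d) (w : List (Letter P.d)) (h : netDisp (m :: w) m.1 = 0) :
    m.flip ∈ w := by
  obtain ⟨c, s⟩ := m
  rw [netDisp_cons] at h
  simp only [if_true] at h
  cases s
  · exact (mem_of_netDisp_ne' c w).1 (by simp at h; linarith)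
  · exact (mem_of_netDisp_ne' c w).2 (by simp at h; linarith)

/-- Removing a cancelling pair `m … m̄` keeps every net displacement. [folklore] -/
private theorem netDisp_remove_pair' (m : Letter P.d) (B C : List (Letter P.d)) (μ : Fin P.d) :
    netDisp (m :: (B ++ m.flip :: C)) μ = netDisp (B ++ C) μ := by
  obtain ⟨c, s⟩ := m
  simp only [netDisp_cons, T4ReflectionCone.netDisp_append, Letter.flip]
  by_cases hc : c = μ
  · subst hc; cases s <;> simp <;> ring
  · simp [hc]

/-- **THE COVARIANT WORD-GRADIENT STOKES BOUND**, by induction on the length (exactly the scheme of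
`LatticeWordStokes.dist1_holAt_le_of_netDisp_eq_zero`): if every plaquette variable of `U` is within `a ≥ 0` of `1` and every plaquette
gradient in direction `ν` is `≤ b` (`b ≥ 0`), then for every closed word `w` of length `N ≤ ℓ` and every base `x`,
`‖∇_ν𝒰_x(w)‖ ≤ (N²/4)·(b + (32 + 2ℓ²)a²)`. [cite: Balaban1985Averaging, (9) p.19 and (19)-(20) p.21; Balaban1985RegularSpaces, (1.1) p.76] -/
theorem norm_wordGrad_le_of_netDisp_eq_zero {a b : ℝ} {ℓ : ℕ} (ha : 0 ≤ a) (hb0 : 0 ≤ b) (hU : PlaqSmall a U) (ν : Fin P.d)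
    (hb : ∀ (y : Site P j) (κ κ' : Fin P.d), κ ≠ κ' →
      ‖(((U ⟨y.unshift ν, ν⟩)⁻¹ * holAt U (walk (y.unshift ν) (plaqWord κ κ')) * U ⟨y.unshift ν, ν⟩ :
            Matrix.specialUnitaryGroup n ℂ) : Matrix n n ℂ) -
          ((holAt U (walk y (plaqWord κ κ')) : Matrix.specialUnitaryGroup n ℂ) : Matrix n n ℂ)‖ ≤ b) :
    ∀ (N : ℕ) (w : List (Letter P.d)), w.length = N → N ≤ ℓ → (∀ μ, netDisp w μ = 0) → ∀ x : Site P j,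
      ‖(((U ⟨x.unshift ν, ν⟩)⁻¹ * holAt U (walk (x.unshift ν) w) * U ⟨x.unshift ν, ν⟩ :
            Matrix.specialUnitaryGroup n ℂ) : Matrix n n ℂ) - ((holAt U (walk x w) : Matrix.specialUnitaryGroup n ℂ) : Matrix n n ℂ)‖ ≤
        ((N : ℝ) ^ 2 / 4) * (b + (32 + 2 * (ℓ : ℝ) ^ 2) * a ^ 2) := by
  intro N
  induction N using Nat.strong_induction_on with
  | _ N ih =>
    intro w hlen hNℓ hnull x
    have hε : 0 ≤ b + (32 + 2 * (ℓ : ℝ) ^ 2) * a ^ 2 := by positivity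
    cases w with
    | nil =>
      subst hlen
      simp only [walk, holAt_nil, mul_one, inv_mul_cancel, sub_self, norm_zero]
      positivity
    | cons m w' =>
      have hmem : m.flip ∈ w' := flip_mem_of_netDisp_eq_zero' m w' (hnull m.1)
      obtain ⟨B, C, hw'⟩ := List.append_of_mem hmem
      subst hw'
      have hstep := norm_wordGrad_cancel_le U ha hb0 hU ν hb x m B [] C (by simpa using hlen.le.trans hNℓ)
      simp only [List.nil_append] at hstep
      have hnull' : ∀ μ, netDisp (B ++ C) μ = 0 := fun μ => by rw [← netDisp_remove_pair' m B C μ]; exact hnull μ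
      simp only [List.length_cons, List.length_append] at hlen
      have hlen' : (B ++ C).length = N - 2 := by simp; omega
      have h2N : 2 ≤ N := by omega
      have ih' := ih (N - 2) (by omega) (B ++ C) hlen' (by omega) hnull' x
      have hB : (B.length : ℝ) ≤ (N : ℝ) - 2 := by
        have h : (B.length : ℝ) + 2 ≤ N := by exact_mod_cast (show B.length + 2 ≤ N by omega)
        linarith
      have hcast : (((N - 2 : ℕ) : ℝ)) = (N : ℝ) - 2 := by rw [Nat.cast_sub h2N]; norm_num
      calc _ ≤ (B.length : ℝ) * (b + (32 + 2 * (ℓ : ℝ) ^ 2) * a ^ 2) + _ := hstep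
        _ ≤ ((N : ℝ) - 2) * (b + (32 + 2 * (ℓ : ℝ) ^ 2) * a ^ 2) + (((N - 2 : ℕ) : ℝ) ^ 2 / 4) * (b + (32 + 2 * (ℓ : ℝ) ^ 2) * a ^ 2) :=
            add_le_add (mul_le_mul_of_nonneg_right hB hε) ih'
        _ ≤ ((N : ℝ) ^ 2 / 4) * (b + (32 + 2 * (ℓ : ℝ) ^ 2) * a ^ 2) := by rw [hcast]; nlinarith

/-- **THE COVARIANT WORD-GRADIENT STOKES BOUND**, stated with the word's own length: for every CLOSED word `w` with `|w| ≤ ℓ`,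
`‖β_x⁻¹·𝒰_{x−e_ν}(w)·β_x − 𝒰_x(w)‖ ≤ (|w|²/4)·(b + (32 + 2ℓ²)a²)` whenever `PlaqSmall a U` (`a ≥ 0`) and every plaquette-word gradient in
direction `ν` is `≤ b` (`b ≥ 0`).  At `w` = a plaquette word this is the hypothesis; the content is that to first order a closed word's holonomy
«sees» only the plaquettes it encloses, each through its own covariant gradient. [cite: Balaban1985RegularSpaces, (1.1) p.76 and (1.11) p.77] -/
theorem norm_wordGrad_le {a b : ℝ} {ℓ : ℕ} (ha : 0 ≤ a) (hb0 : 0 ≤ b) (hU : PlaqSmall a U) (ν : Fin P.d)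
    (hb : ∀ (y : Site P j) (κ κ' : Fin P.d), κ ≠ κ' →
      ‖(((U ⟨y.unshift ν, ν⟩)⁻¹ * holAt U (walk (y.unshift ν) (plaqWord κ κ')) * U ⟨y.unshift ν, ν⟩ :
            Matrix.specialUnitaryGroup n ℂ) : Matrix n n ℂ) -
          ((holAt U (walk y (plaqWord κ κ')) : Matrix.specialUnitaryGroup n ℂ) : Matrix n n ℂ)‖ ≤ b)
    (w : List (Letter P.d)) (hw : ∀ μ, netDisp w μ = 0) (hwℓ : w.length ≤ ℓ) (x : Site P j) :
    ‖(((U ⟨x.unshift ν, ν⟩)⁻¹ * holAt U (walk (x.unshift ν) w) * U ⟨x.unshift ν, ν⟩ :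
          Matrix.specialUnitaryGroup n ℂ) : Matrix n n ℂ) - ((holAt U (walk x w) : Matrix.specialUnitaryGroup n ℂ) : Matrix n n ℂ)‖ ≤
      (((w.length : ℕ) : ℝ) ^ 2 / 4) * (b + (32 + 2 * (ℓ : ℝ) ^ 2) * a ^ 2) :=
  norm_wordGrad_le_of_netDisp_eq_zero U ha hb0 hU ν hb w.length w rfl hwℓ hw x

end Gradient

end Summit.QuantumFields.YangMills.Theorems.AvgCurvGrad

end
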